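import Literature.NumberTheory.Automorphic.Zelevinsky1980.MaximalParabolicOrbitFiltration
import HarnessLib

/-!
# R90-TF · S1 «Ch10-local» · split place, ROAD β — the diagonal element `d(ϖ)` on the open-orbit classes of
# `Ind_{Q_{N-1,1}}^{GL_N} σ'` (vector-valued form of the open-cell exponent)

Cell `hodgecm-mathlib`, programme R90-TF, section S1, crux H413 (`stmt-HodgeConjecture-24833`), route `HCCMUnconditional`;
prover seat R90-C10-p02, socket S1#7 `R90.S1.SocketSplitInducedIrreducible`, ROAD β «BY SUPPORT OF σ» (non-supercuspidal branch,
all characteristics).  THEOREMS ONLY (no `def`, no instance, no notation, no `sorry`); ONE public theorem; lane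
`--supports stmt-HodgeConjecture-24833`.

THE MATHEMATICS ([BernsteinZelevinskyASENS1977, Thm. 5.2 (open orbit), §7.1]).  `P = Q_{N-1,1} ≤ GL_N(F)` (`N = n + 2`), `σ'` a
smooth representation of `P` on `W`, `ϖ` a uniformizer, `d(ϖ) = diag(1,…,1,ϖ)` (central in the Levi), `d₀(ϖ) = diag(ϖ,1,…,1) =
w₀ d(ϖ) w₀⁻¹`, `K'_m = N' ∩ K_{ϖ^m}` the level box (`m ≥ 1`), `Φ_{K,w}` the standard sections (★ `cellSection`), `r ∈ N'`.
★ `Zelevinsky1980.mk_smoothIndRep_diag_eq_smul_of_mem_vanishingOn` computes `[d(ϖ) · f] = q_F s · [f]` on `I_open` when `d₀(ϖ)`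
acts on `W` by a SCALAR `s` (the character case).  Here the vector-valued form, on the spanning classes `[r⁻¹ · Φ_{K'_m, w}]`:
**`[d(ϖ) · r⁻¹ · Φ_{K'_m, w}] = q_F • [r⁻¹ · Φ_{K'_m, σ'(d₀(ϖ)) w}]`** in the `U_P`-coinvariants — conjugation by `d(ϖ)` expands the
last coordinate of `N'` by `ϖ⁻¹` (index `q_F`, cosets represented in `U_P ∩ N'`, ★ `exists_transversal_conj_box`) and moves the vector
by `σ'(d₀(ϖ))` (★ `smoothIndRep_cellSection_of_conj_mem`).  Together with ★ `R90.S1.mk_translate_cellSection_eq_zero_of_mem_jacquet_ker`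
(the classes factor through the Jacquet module `W_{u₁₀(F)}` at `N = 3`) this is the open-orbit term `i ∘ w ∘ r(σ')` with its
`d(ϖ)`-action, used for `End_{GL₃}(n-Ind(σ ⊠ χ′)) = ℂ` when the `u₁₀`-exponents of `σ` are regular.
HONEST LABEL: an organ of S1#7, socket OPEN; HC_CM is proved only modulo the 7 printed citations (2 remaining named inputs:
hLiu418 = stmt-HodgeConjecture-24832, h413 = stmt-HodgeConjecture-24833) until rung 0 closes.
References: [BernsteinZelevinskyASENS1977] Bernstein–Zelevinsky, Ann. Sci. ÉNS 10 (1977), Thm. 5.2, §7.1 · [Zelevinsky1980] Ann. Sci.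
ÉNS 13 (1980), §1.1, §3.2.
-/

set_option autoImplicit false
set_option linter.dupNamespace false

noncomputable section

open Matrix Literature.LinearAlgebra.Matrix.DiagonalTorus
open Literature.NumberTheory.Automorphic Literature.NumberTheory.Automorphic.Zelevinsky1980
open ValuativeRel

namespace Summit.HodgeConjecture.HodgeConjecture.R90.S1

variable {F : Type*} [Field F] [ValuativeRel F] [TopologicalSpace F] [IsNonarchimedeanLocalField F] {n : ℕ}
  {W : Type*} [AddCommGroup W] [Module ℂ W]
  (σ' : Representation ℂ ↥(standardParabolicGL F (lastBlockLabel (n + 2))) W)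

/-- **Vector-valued transversal identity** (★ `mk_smoothIndRep_cellSection_transversal` without the scalar hypothesis `hs`).
Let `a ∈ P'` with `w₀ a w₀⁻¹ ∈ P_c`, `K' ≤ N'` compact open with `K' ≤ a K' a⁻¹`, and `R` a left transversal of `a K' a⁻¹ / K'`
such that `a r⁻¹ a⁻¹ ρ r ∈ U_c` for `ρ ∈ R`.  Then `[a · r⁻¹ · Φ_{K',w}] = #R • [r⁻¹ · Φ_{K', σ'(w₀ a w₀⁻¹) w}]` in the
`U_c`-coinvariants. [cite: BernsteinZelevinskyASENS1977, Thm. 5.2 and §7.1] -/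
private theorem mk_smoothIndRep_cellSection_transversal_vec (hσ' : σ'.IsSmooth) {a : GL (Fin (n + 2)) F}
    (haP' : a ∈ standardParabolicGL F (⇑OrderDual.toDual ∘ revLabel (lastBlockLabel (n + 2))))
    (haP : permGL Fin.revPerm * a * (permGL Fin.revPerm)⁻¹ ∈ standardParabolicGL F (lastBlockLabel (n + 2)))
    (K' : Subgroup ↥(oppositeCellRadical (K := F) (lastBlockLabel (n + 2))))
    (hK'o : IsOpen (K' : Set ↥(oppositeCellRadical (K := F) (lastBlockLabel (n + 2)))))
    (hK'c : IsCompact (K' : Set ↥(oppositeCellRadical (K := F) (lastBlockLabel (n + 2)))))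
    (R : Finset ↥(oppositeCellRadical (K := F) (lastBlockLabel (n + 2)))) (r : GL (Fin (n + 2)) F)
    (hRU : ∀ ρ ∈ R, a * r⁻¹ * a⁻¹ * (ρ : GL (Fin (n + 2)) F) * r ∈ unipotentRadicalGL F (lastBlockLabel (n + 2)))
    (hKs : K' ≤ conjSubgroup haP' K') (hR : IsLeftTransversal (conjSubgroup haP' K') K' R) (w : W) :
    Representation.Coinvariants.mk
        (Representation.restrictUnipotentGL F (lastBlockLabel (n + 2))
          (Representation.smoothIndRep (standardParabolicGL F (lastBlockLabel (n + 2))) σ'))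
        (Representation.smoothIndRep (standardParabolicGL F (lastBlockLabel (n + 2))) σ' a
          (Representation.smoothIndRep (standardParabolicGL F (lastBlockLabel (n + 2))) σ' r⁻¹
            (cellSection σ' (monotone_lastBlockLabel (n + 2)) hσ' K' hK'o hK'c w))) =
      (R.card : ℂ) • Representation.Coinvariants.mk
        (Representation.restrictUnipotentGL F (lastBlockLabel (n + 2))
          (Representation.smoothIndRep (standardParabolicGL F (lastBlockLabel (n + 2))) σ'))
        (Representation.smoothIndRep (standardParabolicGL F (lastBlockLabel (n + 2))) σ' r⁻¹
          (cellSection σ' (monotone_lastBlockLabel (n + 2)) hσ' K' hK'o hK'c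
            (σ' ⟨permGL Fin.revPerm * a * (permGL Fin.revPerm)⁻¹, haP⟩ w))) := by
  classical
  have hc : Monotone (lastBlockLabel (n + 2)) := monotone_lastBlockLabel (n + 2)
  set I := Representation.smoothIndRep (standardParabolicGL F (lastBlockLabel (n + 2))) σ' with hI
  set w' : W := σ' ⟨permGL Fin.revPerm * a * (permGL Fin.revPerm)⁻¹, haP⟩ w with hw'
  -- `a r⁻¹ = (a r⁻¹ a⁻¹) a`
  have e1 : I a (I r⁻¹ (cellSection σ' hc hσ' K' hK'o hK'c w)) =
      I (a * r⁻¹ * a⁻¹) (I a (cellSection σ' hc hσ' K' hK'o hK'c w)) := by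
    rw [← Module.End.mul_apply, ← map_mul, ← Module.End.mul_apply, ← map_mul, inv_mul_cancel_right]
  -- `a · Φ_{K',w} = Φ_{aK'a⁻¹, w'} = ∑_ρ ρ · Φ_{K', w'}`
  have e2a := smoothIndRep_cellSection_of_conj_mem σ' hc hσ' K' hK'o hK'c w haP' haP
  have e2d := cellSection_eq_sum_smoothIndRep hc hσ' hKs (isOpen_conjSubgroup _ hK'o) (isCompact_conjSubgroup _ hK'c)
    hK'o hK'c hR w'
  rw [e1, hI, e2a, ← hw', e2d, map_sum, map_sum]
  -- each term has the class of `r⁻¹ · Φ_{K',w'}`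
  have e3 : ∀ ρ ∈ R,
      Representation.Coinvariants.mk (Representation.restrictUnipotentGL F (lastBlockLabel (n + 2)) I)
          (I (a * r⁻¹ * a⁻¹) (I ((ρ : ↥(oppositeCellRadical (K := F) (lastBlockLabel (n + 2)))) : GL (Fin (n + 2)) F)
            (cellSection σ' hc hσ' K' hK'o hK'c w'))) =
        Representation.Coinvariants.mk (Representation.restrictUnipotentGL F (lastBlockLabel (n + 2)) I)
          (I r⁻¹ (cellSection σ' hc hσ' K' hK'o hK'c w')) := by
    intro ρ hρ
    have e4 : a * r⁻¹ * a⁻¹ * (ρ : GL (Fin (n + 2)) F) = (a * r⁻¹ * a⁻¹ * (ρ : GL (Fin (n + 2)) F) * r) * r⁻¹ := by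
      rw [mul_inv_cancel_right]
    rw [← Module.End.mul_apply, ← map_mul, e4, map_mul, Module.End.mul_apply]
    exact mk_smoothIndRep_eq_of_mem_unipotentRadicalGL σ' (hRU ρ hρ) _
  rw [Finset.sum_congr rfl e3, Finset.sum_const, ← Nat.cast_smul_eq_nsmul ℂ]

/-- **`d(ϖ)` on the open-orbit classes (vector-valued open-cell exponent).**  Let `σ'` be a smooth representation of
`P = Q_{N-1,1} ≤ GL_N(F)` on `W`, `ϖ` a uniformizer, `m ≥ 1`, `K'_m = N' ∩ K_{ϖ^m}` the level box, `r ∈ N'`, `w ∈ W`.  Then in the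
`U_P`-coinvariants of `Ind_P^{GL_N} σ'`:
`[d(ϖ) · r⁻¹ · Φ_{K'_m, w}] = q_F • [r⁻¹ · Φ_{K'_m, σ'(d₀(ϖ)) w}]`, `d(ϖ) = diag(1,…,1,ϖ)`, `d₀(ϖ) = diag(ϖ,1,…,1) = w₀ d(ϖ) w₀⁻¹`,
`q_F = #𝓀_F` (conjugation by `d(ϖ)` expands the last coordinate of `N'` by `ϖ⁻¹`; the `q_F` cosets of `d K'_m d⁻¹ / K'_m` are
represented in `U_P ∩ N'`, ★ `exists_transversal_conj_box`).  The character case (`σ'(d₀(ϖ)) = s`) is ★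
`mk_smoothIndRep_diag_eq_smul_of_mem_vanishingOn`. [cite: BernsteinZelevinskyASENS1977, Thm. 5.2 and §7.1] [cite: Zelevinsky1980, §3.2] -/
theorem mk_smoothIndRep_diag_translate_cellSection (hσ' : σ'.IsSmooth) {ϖ : F} (hϖ : IsUniformizingElement ϖ)
    {m : ℕ} (hm1 : 1 ≤ m) (r : ↥(oppositeCellRadical (K := F) (lastBlockLabel (n + 2)))) (w : W) :
    Representation.Coinvariants.mk
        (Representation.restrictUnipotentGL F (lastBlockLabel (n + 2))
          (Representation.smoothIndRep (standardParabolicGL F (lastBlockLabel (n + 2))) σ'))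
        (Representation.smoothIndRep (standardParabolicGL F (lastBlockLabel (n + 2))) σ'
          (diagGL (Fin (n + 2)) (Function.update 1 (Fin.last (n + 1)) (Units.mk0 ϖ hϖ.ne_zero)))
          (Representation.smoothIndRep (standardParabolicGL F (lastBlockLabel (n + 2))) σ' ((r : GL (Fin (n + 2)) F))⁻¹
            (cellSection σ' (monotone_lastBlockLabel (n + 2)) hσ'
              ((congruenceGL (n + 2) (valuation F ϖ ^ m)).comap (oppositeCellRadical (K := F) (lastBlockLabel (n + 2))).subtype)
              (isOpen_comap_congruenceGL (pow_ne_zero _ ((Valuation.ne_zero_iff _).mpr hϖ.ne_zero)))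
              (isCompact_comap_congruenceGL _) w))) =
      (Literature.NumberTheory.GaloisRepresentations.IsNonarchimedeanLocalField.residueFieldCard F : ℂ) •
        Representation.Coinvariants.mk
          (Representation.restrictUnipotentGL F (lastBlockLabel (n + 2))
            (Representation.smoothIndRep (standardParabolicGL F (lastBlockLabel (n + 2))) σ'))
          (Representation.smoothIndRep (standardParabolicGL F (lastBlockLabel (n + 2))) σ' ((r : GL (Fin (n + 2)) F))⁻¹
            (cellSection σ' (monotone_lastBlockLabel (n + 2)) hσ'
              ((congruenceGL (n + 2) (valuation F ϖ ^ m)).comap (oppositeCellRadical (K := F) (lastBlockLabel (n + 2))).subtype)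
              (isOpen_comap_congruenceGL (pow_ne_zero _ ((Valuation.ne_zero_iff _).mpr hϖ.ne_zero)))
              (isCompact_comap_congruenceGL _)
              (σ' ⟨diagGL (Fin (n + 2)) (Function.update 1 0 (Units.mk0 ϖ hϖ.ne_zero)), diagGL_mem_standardParabolicGL _ _⟩ w))) := by
  classical
  obtain ⟨Rκ, hcard, hRU, hKs, hRκ⟩ := exists_transversal_conj_box (F := F) (n := n) hϖ hm1
  have haP : permGL Fin.revPerm * diagGL (Fin (n + 2)) (Function.update 1 (Fin.last (n + 1)) (Units.mk0 ϖ hϖ.ne_zero)) *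
      (permGL Fin.revPerm)⁻¹ ∈ standardParabolicGL F (lastBlockLabel (n + 2)) := by
    rw [permGL_rev_mul_diag_mul_inv]; exact diagGL_mem_standardParabolicGL _ _
  have haconj : (⟨permGL Fin.revPerm * diagGL (Fin (n + 2)) (Function.update 1 (Fin.last (n + 1)) (Units.mk0 ϖ hϖ.ne_zero)) *
      (permGL Fin.revPerm)⁻¹, haP⟩ : ↥(standardParabolicGL F (lastBlockLabel (n + 2)))) =
      ⟨diagGL (Fin (n + 2)) (Function.update 1 0 (Units.mk0 ϖ hϖ.ne_zero)), diagGL_mem_standardParabolicGL _ _⟩ :=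
    Subtype.ext (permGL_rev_mul_diag_mul_inv _)
  rw [← hcard, ← haconj]
  exact mk_smoothIndRep_cellSection_transversal_vec σ' hσ' _ haP _ _ _ Rκ _
    (fun ρ hρ => diag_conj_mul_mem_unipotentRadicalGL _ r.2 ρ.2 (hRU ρ hρ).2) hKs hRκ w

end Summit.HodgeConjecture.HodgeConjecture.R90.S1

end
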